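import Summits.CriticalPhenomena.PercolationContinuityZ3.Theorems.Transplant.SnowballSqueezeStep
import HarnessLib

/-!
# Door D12, item T6 (Defs): the stretched upper growth rate `GrowthUpperStretched` — a hypothesis shape WITH binders, generic over graphs

Defs file (`--supports stmt-CriticalPhenomena-4575`), lane `prim-bschramm`, seat `prim-bschramm-gen-1` gen 11 (GEN pen); lead g28 RIDER R-T6-1 (bus 2026-08-29 #9402:
"put `GrowthUpperStretched (G) (o) (α′ C : ℝ) : Prop` in a TINY Defs file, filed first; T6 «GrigorchukWitnessUniquenessZone» stays kind proof").  builds on p205010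
(kernel theorem, internal audit signed; external expert review pending) — nothing in this file uses p205010.  ONE def (a hypothesis shape with binders — NOTHING
asserted; in particular no growth rate of `𝔊` or `𝔊 × ℤ` is claimed here), one transfer lemma; no instance, no notation, no sorry, no `@[conjecture]`.
[cite: Grigorchuk1984, Thm. (upper growth bound e^{n^β})] [cite: BenjaminiSchramm1996, §2 (Cayley graphs)]
-/

noncomputable section

namespace Summit.CriticalPhenomena.PercolationContinuityZ3.Theorems.Transplant

open SimpleGraph Literature.Barriers.CriticalPhenomena SnowballSqueeze
open scoped Classical

variable {V : Type}

/-- **`GrowthUpperStretched G o α C`** — a stretched-exponential UPPER growth rate at the base point `o`: `log |B(o, n)| ≤ C·n^α + C` for every `n`.  A hypothesis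
SHAPE with binders; nothing asserted.  For `Cay(𝔊; a,b,c,d)` (first Grigorchuk group) it holds with some `α < 1` in PRINT — Grigorchuk 1984 (upper bound
`γ(n) ≤ e^{n^β}`, `β = log₃₂ 31`), Bartholdi 1998 (`α ≈ 0.7674`) — while the tree's «GrigorchukSubexponentialGrowth» proves only the `o(n)` form; the RATE is
kernel-reachable from «GrigorchukGrowthRecursion» `gammaW_recursion` by the concavity induction (design desk #9397; a separate item `stdCay_growthUpperStretched`).
[cite: Grigorchuk1984, Thm. (upper growth bound)] -/
def GrowthUpperStretched (G : SimpleGraph V) (o : V) (α C : ℝ) : Prop :=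
  ∀ n : ℕ, Real.log (ballVolume G o n : ℝ) ≤ C * (n : ℝ) ^ α + C

/-- On a vertex-transitive graph the rate transfers between base points (balls of equal radius have equal volume, «SnowballSqueezeStep»
`ballVolume_eq_of_isGraphTransitive`). [cite: BenjaminiSchramm1996, §2 (transitive graphs)] -/
theorem growthUpperStretched_of_isGraphTransitive {G : SimpleGraph V} (htrans : IsGraphTransitive G) {o : V} {α C : ℝ}
    (h : GrowthUpperStretched G o α C) (o' : V) : GrowthUpperStretched G o' α C := fun n => by
  rw [ballVolume_eq_of_isGraphTransitive G htrans o o' n]; exact h n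

end Summit.CriticalPhenomena.PercolationContinuityZ3.Theorems.Transplant
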